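import Summits.AtomisticToContinuum.BoseEinsteinCondensation.Theorems.BECInsertionCorrectorCorrectorClosureNearMinimiserRigidity
import Summits.AtomisticToContinuum.BoseEinsteinCondensation.Theorems.BECInsertionCorrectorCorrectorClosureGroundStateExists
import Summits.AtomisticToContinuum.BoseEinsteinCondensation.Theorems.BECConjugateDominationHardCoreExtensionGroundStateRegularity
import Summits.AtomisticToContinuum.BoseEinsteinCondensation.Theorems.BECFeynmanVortexAreaTorusGroundStateOfRegularity
import Summits.AtomisticToContinuum.BoseEinsteinCondensation.Theorems.CorrectorClosure.Negative.InsertionResidueLoadBearing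
import HarnessLib

/-!
# The `C¹` ground-state frame of the torus at fixed small density (line `geometric-mean-corrector`,
# crux `BECInsertionCorrector.CorrectorClosure`, item stmt-AtomisticToContinuum-12058)

For a BOUNDED repulsive finite-range pair potential `v` there is `ρ₁ > 0` such that for `0 < ρ < ρ₁`
and all large `N`, in the box `L = ((N+1)/ρ)^{1/3}`: the periodised potential is bounded; the canonical
torus Feynman–Kac ground states `Θ₀ = periodicFKGroundState v N L` and `Φ₀ = periodicFKGroundState v (N+1) L`
are FK witnesses, continuous and strictly positive; and, read in `ℂ`, they are periodic trial states (the
`C¹` Bose class `PeriodicTrialState`) ATTAINING the periodic `N`- and `(N+1)`-body energies, which are finite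
(`groundStateFrame`). This is the assembly of four landed results — existence/continuity/positivity
eventually in `N` (`ResidueAreaLaw.stub_groundStateExists`), `C¹`-regularity of FK witnesses for bounded
periodised potentials (`ThirdLawCurrentFloor.stub_periodicGroundStateRegularity`), "a `C¹` FK witness has
`periodicEnergy ≤ E₀`" (`TorusGroundState.periodicEnergy_le_of_isPeriodicGroundStateFK`) and the variational
principle — and it discharges, for bounded `v`, the three frame stubs S0–S2 of skeleton v1 of the line
(truncation-stable response, truncation removal, ground-state rigidity: no truncation is needed). Two
reading lemmas used by the line's glue are included: a positive real function read in `ℂ` is "real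
positive" in the stubs' sense (`realPos_of_ofReal`), and the complex insertion overlap of two such states is
the real residue `ofReal (L⁻³(∫Θ₀∫_cellΦ₀)²)` of the rigidity lemma (`residue_ofReal_eq`).
-/

noncomputable section

namespace Summit.AtomisticToContinuum.BoseEinsteinCondensation.Theorems.CorrectorClosure.GeometricMeanCorrector

open MeasureTheory Filter
open scoped ENNReal NNReal ComplexConjugate BigOperators
open Literature.MathematicalPhysics.QuantumManyBody.BoseGas
open Summit.AtomisticToContinuum.BoseEinsteinCondensation.Theorems.CorrectorClosure.ResidueAreaLaw
  (stub_groundStateExists)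
open Summit.AtomisticToContinuum.BoseEinsteinCondensation.Theorems.CorrectorClosure.HealingScaleKacInsertion
  (overlap_ofReal)
open Summit.AtomisticToContinuum.BoseEinsteinCondensation.Cruxes.HardCoreExtension.ThirdLawCurrentFloor
  (stub_periodicGroundStateRegularity)
open Summit.AtomisticToContinuum.BoseEinsteinCondensation.Theorems.CorrectorClosure.Negative (sideLength_succ_pos)
open Summit.AtomisticToContinuum.BoseEinsteinCondensation.Theorems.TorusGroundState
  (periodicEnergy_le_of_isPeriodicGroundStateFK)


/-- **A `C¹` Feynman–Kac ground state, read in `ℂ`, is a periodic trial state** (the structure fields: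
`C¹` by composition with `ofReal`, periodicity / Bose symmetry / cell normalisation from `IsPeriodicGroundStateFK`).
[folklore] -/
theorem exists_trialState_of_fk {M : ℕ} {L : ℝ} {v : ℝ → ℝ≥0∞} {Ψ₀ : Config M → ℝ}
    (hGS : IsPeriodicGroundStateFK v L Ψ₀) (hC1 : ContDiff ℝ 1 Ψ₀) :
    ∃ Ψ : PeriodicTrialState M L, Ψ.ψ = fun X => ((Ψ₀ X : ℝ) : ℂ) := by
  have hnormΨ : ∫⁻ X in cellN M L, ((‖((Ψ₀ X : ℝ) : ℂ)‖₊ : ℝ≥0∞)) ^ 2 = 1 := by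
    have h1 : ∀ X, ((‖((Ψ₀ X : ℝ) : ℂ)‖₊ : ℝ≥0∞)) ^ 2 = ENNReal.ofReal (Ψ₀ X) ^ 2 := fun X => by
      rw [ennnorm_sq_ofReal_periodic, ENNReal.ofReal_pow (hGS.nonneg X)]
    simp_rw [h1]
    exact hGS.norm_eq
  exact ⟨{ ψ := fun X => ((Ψ₀ X : ℝ) : ℂ)
           contDiff := Complex.ofRealCLM.contDiff.comp hC1
           periodic := fun X i k => by
             show ((Ψ₀ (X + Pi.single i (EuclideanSpace.single k L)) : ℝ) : ℂ) = ((Ψ₀ X : ℝ) : ℂ)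
             rw [hGS.periodic]
           symm := fun σ X => by
             show ((Ψ₀ (X ∘ σ) : ℝ) : ℂ) = ((Ψ₀ X : ℝ) : ℂ)
             rw [hGS.symm]
           norm_eq := hnormΨ }, rfl⟩

/-- A strictly positive real function read in `ℂ` is "real positive" in the sense of the line's stubs:
`Ψ = ‖Ψ‖` and `‖Ψ‖ > 0` pointwise. [folklore] -/
theorem realPos_of_ofReal {M : ℕ} {L : ℝ} {Ψ₀ : Config M → ℝ} (hpos : ∀ X, 0 < Ψ₀ X)
    (Ψ : PeriodicTrialState M L) (hΨ : Ψ.ψ = fun X => ((Ψ₀ X : ℝ) : ℂ)) :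
    ∀ X, Ψ.ψ X = (‖Ψ.ψ X‖ : ℂ) ∧ 0 < ‖Ψ.ψ X‖ := by
  intro X
  have h1 : Ψ.ψ X = ((Ψ₀ X : ℝ) : ℂ) := by rw [hΨ]
  have h2 : ‖Ψ.ψ X‖ = Ψ₀ X := by
    rw [h1, Complex.norm_real, Real.norm_of_nonneg (hpos X).le]
  refine ⟨?_, ?_⟩
  · rw [h2, h1]
  · rw [h2]; exact hpos X

/-- The complex insertion overlap of two real functions read in `ℂ`, in the residue form of `InsertionResidue`,
IS the real residue `ofReal (L⁻³ (∫ Θ₀ ∫_cell Φ₀)²)` of the rigidity lemma `stub_nearMinimiserRigidity`.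
[folklore] -/
theorem residue_ofReal_eq {N : ℕ} (L : ℝ) {Θ₀ : Config N → ℝ} {Φ₀ : Config (N + 1) → ℝ}
    (Θ : PeriodicTrialState N L) (Φ : PeriodicTrialState (N + 1) L)
    (hΘ : Θ.ψ = fun X => ((Θ₀ X : ℝ) : ℂ)) (hΦ : Φ.ψ = fun Z => ((Φ₀ Z : ℝ) : ℂ)) :
    ENNReal.ofReal ((L ^ 3)⁻¹) *
        (‖∫ X in cellN N L, conj (Θ.ψ X) * ∫ x in cell L, Φ.ψ (Matrix.vecCons x X)‖₊ : ℝ≥0∞) ^ 2 =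
      ENNReal.ofReal ((L ^ 3)⁻¹ *
        (∫ X in cellN N L, Θ₀ X * ∫ x in cell L, Φ₀ (Matrix.vecCons x X)) ^ 2) := by
  rw [hΘ, hΦ]
  simp only []
  rw [overlap_ofReal L Θ₀ Φ₀, ennnorm_sq_ofReal_periodic, ← ENNReal.ofReal_mul' (sq_nonneg _)]

/-- **The `C¹` ground-state frame of the line for BOUNDED potentials (skeleton-v1 stubs S0–S2 discharged).** For a
bounded repulsive finite-range `v` there is `ρ₁ > 0` such that for `0 < ρ < ρ₁` and all large `N`, in the box
`L = ((N+1)/ρ)^{1/3}`: the periodised potential is bounded; the canonical torus Feynman–Kac ground states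
`Θ₀ = periodicFKGroundState v N L` and `Φ₀ = periodicFKGroundState v (N+1) L` are FK witnesses, continuous and strictly
positive (`stub_groundStateExists`); they are `C¹` (`stub_periodicGroundStateRegularity`); and read in `ℂ` they are
periodic trial states ATTAINING the periodic `N`- and `(N+1)`-body energies, which are finite
(`periodicEnergy_le_of_isPeriodicGroundStateFK` and the variational principle `periodicGroundStateEnergy_le`).
[cite: ReedSimonIV1978, Thm XIII.47] -/
theorem groundStateFrame (v : ℝ → ℝ≥0∞) (hv : IsRepulsiveFiniteRange v) (hbdd : ∃ C : ℝ≥0, ∀ r, v r ≤ C) :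
    ∃ ρ₁ : ℝ, 0 < ρ₁ ∧ ∀ ρ : ℝ, 0 < ρ → ρ < ρ₁ → ∀ᶠ N : ℕ in atTop,
      (∃ C : ℝ≥0, ∀ x, periodizedPotential v (sideLength ρ (N + 1)) x ≤ C) ∧
      (IsPeriodicGroundStateFK v (sideLength ρ (N + 1)) (periodicFKGroundState v N (sideLength ρ (N + 1))) ∧
        Continuous (periodicFKGroundState v N (sideLength ρ (N + 1))) ∧
        ∀ X, 0 < periodicFKGroundState v N (sideLength ρ (N + 1)) X) ∧
      (IsPeriodicGroundStateFK v (sideLength ρ (N + 1))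
          (periodicFKGroundState v (N + 1) (sideLength ρ (N + 1))) ∧
        Continuous (periodicFKGroundState v (N + 1) (sideLength ρ (N + 1))) ∧
        ∀ X, 0 < periodicFKGroundState v (N + 1) (sideLength ρ (N + 1)) X) ∧
      ∃ (Θ : PeriodicTrialState N (sideLength ρ (N + 1)))
        (Φ : PeriodicTrialState (N + 1) (sideLength ρ (N + 1))),
        (Θ.ψ = fun X => ((periodicFKGroundState v N (sideLength ρ (N + 1)) X : ℝ) : ℂ)) ∧
        (Φ.ψ = fun Z => ((periodicFKGroundState v (N + 1) (sideLength ρ (N + 1)) Z : ℝ) : ℂ)) ∧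
        periodicEnergy v Θ = periodicGroundStateEnergy v N (sideLength ρ (N + 1)) ∧
        periodicEnergy v Φ = periodicGroundStateEnergy v (N + 1) (sideLength ρ (N + 1)) ∧
        periodicEnergy v Θ ≠ ⊤ ∧ periodicEnergy v Φ ≠ ⊤ := by
  obtain ⟨ρ₁, hρ₁, hGS⟩ := stub_groundStateExists v hv hbdd
  refine ⟨ρ₁, hρ₁, fun ρ hρ hρ₁' => ?_⟩
  filter_upwards [hGS ρ hρ hρ₁', eventually_ge_atTop 1] with N hN hN1
  obtain ⟨hb, ⟨hΘ, hΘc, hΘp⟩, ⟨hΦ, hΦc, hΦp⟩⟩ := hN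
  refine ⟨hb, ⟨hΘ, hΘc, hΘp⟩, ⟨hΦ, hΦc, hΦp⟩, ?_⟩
  set L : ℝ := sideLength ρ (N + 1) with hL_def
  have hL : 0 < L := sideLength_succ_pos hρ N
  obtain ⟨C, hC⟩ := hb
  set Θ₀ : Config N → ℝ := periodicFKGroundState v N L with hΘ₀_def
  set Φ₀ : Config (N + 1) → ℝ := periodicFKGroundState v (N + 1) L with hΦ₀_def
  -- `C¹`-regularity of both Feynman–Kac ground states (bounded periodisation)
  have hΘC1 : ContDiff ℝ 1 Θ₀ :=
    stub_periodicGroundStateRegularity N L v hN1 hL hv.1 ⟨C, hC⟩ Θ₀ hΘ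
  have hΦC1 : ContDiff ℝ 1 Φ₀ :=
    stub_periodicGroundStateRegularity (N + 1) L v (Nat.le_add_left 1 N) hL hv.1 ⟨C, hC⟩ Φ₀ hΦ
  -- the trial states and their energies
  obtain ⟨Θ, hΘψ⟩ := exists_trialState_of_fk hΘ hΘC1
  obtain ⟨Φ, hΦψ⟩ := exists_trialState_of_fk hΦ hΦC1
  have hEΘ : periodicEnergy v Θ = periodicGroundStateEnergy v N L :=
    le_antisymm (periodicEnergy_le_of_isPeriodicGroundStateFK hL hv.1 hC hΘ hΘC1 Θ hΘψ)
      (periodicGroundStateEnergy_le v Θ)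
  have hEΦ : periodicEnergy v Φ = periodicGroundStateEnergy v (N + 1) L :=
    le_antisymm (periodicEnergy_le_of_isPeriodicGroundStateFK hL hv.1 hC hΦ hΦC1 Φ hΦψ)
      (periodicGroundStateEnergy_le v Φ)
  refine ⟨Θ, Φ, hΘψ, hΦψ, hEΘ, hEΦ, ?_, ?_⟩
  · rw [hEΘ]; exact hΘ.energy_ne_top
  · rw [hEΦ]; exact hΦ.energy_ne_top

end Summit.AtomisticToContinuum.BoseEinsteinCondensation.Theorems.CorrectorClosure.GeometricMeanCorrector

end
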